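/-
Copyright: lit-balaban Phase-2 proof seat p29 (gen 30).  Statement-level skeleton of a published paper; no proof claims beyond what the
kernel checks below.
-/
import Literature.MathematicalPhysics.QuantumFieldTheory.BalabanImbrieJaffe1984to88.BIJ88LocDerivHolder230SmallFieldTorus

/-!
# `BalabanImbrieJaffe1984to88.BIJ88LocDerivHolder230SmallPlaquetteTorus` — T. Bałaban, J. Imbrie, A. Jaffe, *Effective action and cluster
properties of the abelian Higgs model*, Commun. Math. Phys. **114** (1988) 257–315 [BalabanImbrieJaffe1988], Sect. 2 p. 263 [PDF 7], the
sentence after (2.33): *"Bounds analogous to (2.30), (2.31) hold for covariant derivatives and Hölder derivatives of G_{k,loc}(u) of order less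
than two"* — **THE MEMBER OF TOP ORDER `1 + θ` OF (2.30) FOR `G_{k,loc}(u)` ON THE WHOLE GAUGE ORBIT OF A SMALL FIELD, AND UNDER THE PRINTED
PLAQUETTE SMALLNESS (7.3.1) ALONE** (no gauge condition on `u`; thresholds depending on `(d, L^k)` only), for the printed localization data on
the torus (gen 26's cubes `{□_α}` / weights `λ_α` of (2.27), a smooth cut-off `ζ″` — instance: r18's product cut-off `ζ^Π(R₁, R₀)` of (2.29)) —
the companion of gen 29's `BIJ88LocDerivHolder230SmallFieldTorus` (the member under p27's bondwise `(T, δ)` smallness INSIDE `Ω₀`), obtained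
from it by the change of gauge of [BalabanImbrieJaffe1985] p. 326 made `k`-block by `k`-block (p34's `smallField_blockGauge`) — the route by
which p27 gen 35 derived `holder19_smallPlaquette_cube_uniform` from `holder19_smallField_cube` for the cube propagators.

statement-level skeleton of published theorems with citation tags; proofs where landed; nothing here is a claim about the Yang–Mills mass gap

PDF held: `paper:balaban1988-cmp114-bij-abelian-higgs-effective-action` (journal page = PDF page + 256); p. 263 [PDF 7] re-read this session on
the text layer (`lit read … --pages 7`) AND on the page image `run/shared/lean/pub/lit-balaban/lit-balaban-p31/renders/original-p007-x2.png`;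
[BalabanImbrieJaffe1985] = T. Bałaban, J. Imbrie, A. Jaffe, *Renormalization of the Higgs model: minimizers, propagators and the stability of
mean field theory*, Commun. Math. Phys. **97** (1985) 299–329, (2.7) p. 303 (gauge covariance) and (7.3.1) p. 326: *"|v(∂p) − 1| ≦ e_kμ(e_k)"*,
*"The propagators arising from Δ_k(u_k), under the restriction (7.3.1) on the gauge field, also satisfy the regularity and decay estimates of
[7]. … by change of gauge u_k can be transformed in a local region Λ into a configuration of the form exp[ie_kηA], where A is smooth and
small"* (quoted from p27's/p34's headers of record, which re-read p. 326); [6] = [Balaban1983RegularityDecay] p. 573 (1.9).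

CITATION HEADER (lean-in-tree rule).  Part of the lit-balaban TYPED SKELETON (HOME `run/shared/lean/pub/lit-balaban/`), PHASE-2 proof seat
p29 gen 30 (unit `lit-balaban-p29-g30`; TAKING line HOME/STATUS.md 2026-08-23T05:27:03Z — own lineage: gen 29's HANDOFF successor target (P)
*"the (7.3.1)-ONLY variant of the 1 + θ member"* and (G) *"gauge-orbit corollaries"*; free-target protocol G.5-34(d)).  Rows **C2.Claim@263** /
**C2.Eq2.30** (owner r18; the abstract hence-step is p08's `BIJ88HolderDecay230`, unchanged).  Kind: theorems only (no definition, no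
`Prop`-valued fact; gen 26–29's, p27's, p30's, p34's declarations used BY NAME; v1.1 adds only the private parameter record `P2` of the §5 instance).

THE PRINTED TEXT (p. 263, verbatim and IN PRINT ORDER; (2.29) precedes).  *"The boundary conditions are always at a distance O(r(e_k)) from
x₁, x₂, so a straightforward application of the random walk expansion of [6] shows that |(G_{k,loc}(u)f)(x)| ≦ ce^{−c dist(suppt f,x)}‖f‖_∞,
(2.30) |(G_{k,loc}(u)f − G_k(Ω,u)f)(x)| ≦ e^{−cr(e_k)}e^{−c dist(suppt f,x)}‖f‖_∞, (2.31) for dist(x, Ω^c) ≧ O(r(e_k)). [Each G_k(□_α,u) is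
close to G_k(Ω,u) for the relevant x₁, x₂, therefore the convex combination and G_{k,loc} are close also.] We assume that u is smooth in the
□_α's entering the sum in (2.27); for (2.31) we assume smoothness throughout the subset Ω ⊂ T_η. This means that in a neighborhood of each □_α
there exists an A, λ such that u = exp[ie_kη(A + ∂λ)] with |∂A|, |∂*A| ≦ O(p(e_k)). (2.32) … Bounds analogous to (2.30), (2.31) hold for
covariant derivatives and Hölder derivatives of G_{k,loc}(u) of order less than two."*

THE MECHANISM (ours, declared — gauge covariance, then p34's blockwise centred gauge).  (§1) For every gauge transformation `h` and every
`U(1)` field `u`: `G_{k,loc}(u^h)(hf) = h·G_{k,loc}(u)f` (gen 26's `gLocT_gaugeAct`: `G_{k,loc}(u^h) = M_hG_{k,loc}(u)M_hᴴ`, the cubes being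
unions of `k`-blocks), `(D_{u^h}(hφ))(b) = h(b₋)·(D_uφ)(b)` (p30's `covD_gaugeAct`) and `U^h(Γ_{x₁,x₂}) = h(x₁)U(Γ_{x₁,x₂})\overline{h(x₂)}` (p27's
`stairHol_gaugeAct`), hence `U^h(Γ)(D_{u^h}G_{k,loc}(u^h)(hf))(x₂,μ) − (D_{u^h}G_{k,loc}(u^h)(hf))(x₁,μ) = h(x₁)·[U(Γ)(D_uG_{k,loc}(u)f)(x₂,μ) −
(D_uG_{k,loc}(u)f)(x₁,μ)]` — the order-`1 + θ` Hölder quantity has a gauge-invariant modulus, and `hf` has the size and support of `f`.  (§2)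
Therefore gen 29's `derivHolder230_smallField_of_smooth`, applied to a gauge copy `u^h` that meets its bondwise `(T, δ)` hypotheses inside
`Ω₀`, bounds the quantity for `u` itself (the plaquette hypothesis is gauge invariant, p34's `norm_toC_plaqHol_gaugeAct_sub_one`).  (§3) Under
the plaquette bound `|u(∂p) − 1| ≤ θ_p` alone, p34's blockwise centred gauge `h(z) =` p30's centred axial gauge of the `k`-block of `z`
(`smallField_blockGauge`, block balls not wrapping: `2(L^k − 1) + 4 < |T|`) makes `u^h` bondwise `T`-small on the intra-block bonds for any
`T ≥ d(L^k − 1)θ_p` with block holonomies within `(d+1)(L^k − 1)T` of `1` — everywhere, in particular inside `Ω₀`.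

WHAT IS PROVED (theorems only; 0 `sorry`; standard axioms).
* §1 `transportedCovDDiff_gaugeAct`, `norm_transportedCovDDiff_gaugeAct` (any level `j`, any `ψ`), `gLocT_gaugeAct_mulVec` (any cube family of
  `k`-block unions), `isBlockUnion_cubeFam` (gen 26's torus cubes are `k`-block unions), **`norm_derivHolderQty_gLocT_gaugeAct`** (the modulus
  of the order-`1 + θ` quantity of `G_{k,loc}` for the data of record is gauge invariant).
* §2 **`derivHolder230_gaugeCopy_of_smooth`** — gen 29's `derivHolder230_smallField_of_smooth` VERBATIM (same `t₀, c₀`, same data, same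
  conclusion for `u`) with the bondwise `(T, δ)` hypotheses inside `Ω₀` asked of a gauge copy `u^h`, `h` arbitrary.
* §3 **`derivHolder230_smallPlaquette_of_smooth`** — for `d + 1 ∈ {2,3}`, `L` odd `> 1`, `a > 0`, `0 ≤ θ < 1`, `K₁, K₂ ≥ 0` THERE EXIST
  `t₀, c₀ > 0` depending on `(d, L, a, θ, K₁, K₂)` only such that for every volume (`P.d = d+1`, `P.L = L`), every `1 ≤ k ≤ K_P` with
  `2(L^k − 1) + 4 < |T|`, the geometry and cut-off hypotheses of gen 29 (no-wrap box `Ω₀` with torus gap `≥ R`, `s ≥ 1`, `W ≥ 2s/3 + R₀/2 + R`,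
  `4L^k + 1 < R`, `0 ≤ R₁ < R₀`, `3L^k ≤ R₀`; `|ζ″| ≤ 1`, `= 0` beyond `R₀`, first/second differences `≤ K₁/(R₀−R₁)`, `K₂/(R₀−R₁)²`), every `U(1)`
  field with `|u(∂p) − 1| ≤ θ_p` for all fine plaquettes, `2(d+1)³(L^{2k}θ_p)² ≤ 1`, every `T ≥ d(L^k − 1)θ_p` with
  `2(L^k−1)L^k(d+1)T² + 2((d+1)(L^k−1)T)² ≤ 1/2`, every `μ`, all `x₁, x₂` with the four bond ends in `Ω₀` at chart depth `≥ R₀`, every `f`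
  (`‖f‖_∞ ≤ F`) supported at sup-torus distance `≥ D ≥ 0` from `x₁` and `x₂`:
  `(L^k/|x₁ − x₂|_T)^θ·‖U(Γ_{x₁,x₂})(D_uG_{k,loc}(u)f)(x₂,μ) − (D_uG_{k,loc}(u)f)(x₁,μ)‖ ≤ (L^kε)·c₀·m·(1 + L^k((R₀−R₁)⁻¹ + s⁻¹))²·e^{−t₀D/L^k}·F`,
  `m = (⌊(L^k − 1 + R₀)/s⌋ + 3)^{d+1}` — NO gauge condition on `u`.
* §4 **`derivHolder230_smallPlaquette_zetaPi`** — §3 for r18's `zetaPi R₁ R₀ 0` (`1 ≤ R₁ < R₀ ≤ (|T^{(0)}| − 3)/2`; `K₁ = C_σ`, `K₂ = C_σ² + C_σ`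
  from `Literature.Analysis.Calculus.exists_abs_deriv_and_deriv_deriv_smoothTransition_le`, as in gen 29's §4).
* §5 (v1.1) `derivHolder230_smallPlaquette_zetaPi_instance` — NON-VACUITY: every hypothesis of §4 met at once on the genuine two-dimensional
  `Setup.Params` torus `(ℤ/162)²` (`L = 3`, `k = 1`, `θ = 1/2`, `Ω₀ = [0, 24)²`, `s = 1`, `W = 20`, `R = 14`, `R₁ = 1`, `R₀ = 9`, `u = 1`,
  `θ_p = T = 0`, bonds `⟨(12,12),(13,12)⟩`, `⟨(13,12),(14,12)⟩`); the only definition is the private parameter record `P2` of the instance.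
HONEST SCOPE / DIVERGENCE.  (i)–(ii), (iv)–(vii) of gen 29's file apply unchanged (`d + 1 ∈ {2, 3}`, `L` odd; deep pairs only with the collar
`R > 4L^k + 1`, `R₀ ≥ 3L^k`; smooth cut-offs only; (2.30)-analogue only; p30's staircase as the shortest contour; constants not optimized).
(iii′) The smallness of `u` is now a FINE-plaquette bound `θ_p` on the whole torus with `2(d+1)³(L^{2k}θ_p)² ≤ 1` plus the block-scale
threshold on `T ≥ d(L^k − 1)θ_p` — thresholds from `(d, L^k)` only.  THE PRINTED (7.3.1) constrains the UNIT-lattice plaquettes of `v`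
(`|v(∂p) − 1| ≦ e_kμ(e_k)`); `θ_p ≲ L^{−2k}` is the consistent fine-lattice reading, but nothing is asserted here about that passage (p33's
`BIJ85Claim73PropagatorDecay` lane; referee ref-5 D-g64-1) — the same caveat as p27's/p34's/gen 29's plaquette-only members.  (viii) §2 asks the
`(T, δ)` smallness of ONE gauge copy on all of `Ω₀`; print's *"in a neighborhood of each □_α"* (a gauge per cube) is not needed for §3 because
p34's gauge is blockwise and global.  Imports: gen 29 `BIJ88LocDerivHolder230SmallFieldTorus` only (→ p27 gen 35, p34, p30, gen 26–29).
Literature + Mathlib only.  Unit `lit-balaban-p29` (literature-prover-lit-balaban-p29-g30-0), 2026-08-23; v1.1 (§5 appended, §1–§4 byte-identical)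
2026-08-23.  NOT summit progress.
-/

open scoped BigOperators Matrix ComplexConjugate
open Finset Matrix

namespace Literature.MathematicalPhysics.QuantumFieldTheory.BalabanImbrieJaffe1984to88.BIJ88LocDerivHolder230SmallPlaquetteTorus

open Literature.MathematicalPhysics.QuantumFieldTheory.Balaban1983to89
open BIJ88Sect3Statements (U1 toC cfg covD starB mem_starB norm_toC toC_one toC_mul toC_inv)
open BIJ88NeumannPropagator227Torus (conj_mul_toC)
open BIJ85ScalarPropagatorHolderDecay (stairHol covD_gaugeAct)
open BIJ88NeumannPropagatorSmallFieldCubeHolderDecay (stairHol_gaugeAct)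
open BIJ88NeumannPropagatorSmallFieldCubeDeriv (norm_toC_plaqHol_gaugeAct_sub_one)
open BIJ88NeumannPropagatorSmallPlaquetteRegion (smallField_blockGauge)
open BIJ88NeumannNoZeroModesTorus (IsBlockUnion)
open BIJ88DeltaLoc234Torus (gLocT gLocT_gaugeAct mulOp conjTranspose_mul_mulOp)
open BIJ88NeumannPropagatorFlatDecay (mulOp_mulVec)
open BIJ88NeumannPropagatorFlatDecayCube (cubeT boxCoord isBlockUnion_cubeT)
open BIJ88LocWeights227Torus (labels cubeFam lamFam cubeFam_fits)
open BIJ85BlockAveragesTorusK (blkIter cornerIter holCK)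
open BIJ85CentredAxialGauge (centredGauge)
open GaugeField (gaugeAct plaqHol)

noncomputable section

variable {P : Params} {j : ℕ}

/-! ## §1 Gauge covariance of the order-`1 + θ` Hölder quantity of `G_{k,loc}(u)` -/

/-- **THE TRANSPORTED DIFFERENCE OF COVARIANT DERIVATIVES IS GAUGE COVARIANT**: for every gauge transformation `h`, every field `u`, every
`ψ` and every pair of bonds `⟨x₁, x₁+e_μ⟩`, `⟨x₂, x₂+e_μ⟩`,
`U^h(Γ_{x₁,x₂})(D_{u^h}(hψ))(x₂,μ) − (D_{u^h}(hψ))(x₁,μ) = h(x₁)·[U(Γ_{x₁,x₂})(D_uψ)(x₂,μ) − (D_uψ)(x₁,μ)]` — (2.7) p. 303 for the three factors: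
p27's `stairHol_gaugeAct`, p30's `covD_gaugeAct`, `|h(x₂)| = 1`.
[cite: BalabanImbrieJaffe1985, (2.7) p.303] [cite: Balaban1983RegularityDecay, (1.9) p.573] -/
theorem transportedCovDDiff_gaugeAct (c' : ℝ) (h : GaugeTransf P j U1) (U : GaugeField P j U1) (ψ : Balaban1983to89.Site P j → ℂ)
    (x₁ x₂ : Balaban1983to89.Site P j) (μ : Fin P.d) :
    stairHol (gaugeAct h U) x₁ x₂ * covD c' (cfg (gaugeAct h U)) (fun z => toC (h z) * ψ z) ⟨x₂, μ⟩ -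
        covD c' (cfg (gaugeAct h U)) (fun z => toC (h z) * ψ z) ⟨x₁, μ⟩ =
      toC (h x₁) * (stairHol U x₁ x₂ * covD c' (cfg U) ψ ⟨x₂, μ⟩ - covD c' (cfg U) ψ ⟨x₁, μ⟩) := by
  have hS : stairHol (gaugeAct h U) x₁ x₂ = toC (h x₁) * stairHol U x₁ x₂ * conj (toC (h x₂)) := stairHol_gaugeAct h U x₁ x₂
  have hD₁ : covD c' (cfg (gaugeAct h U)) (fun z => toC (h z) * ψ z) ⟨x₁, μ⟩ = toC (h x₁) * covD c' (cfg U) ψ ⟨x₁, μ⟩ :=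
    covD_gaugeAct _ h U ψ _
  have hD₂ : covD c' (cfg (gaugeAct h U)) (fun z => toC (h z) * ψ z) ⟨x₂, μ⟩ = toC (h x₂) * covD c' (cfg U) ψ ⟨x₂, μ⟩ :=
    covD_gaugeAct _ h U ψ _
  rw [hS, hD₁, hD₂]
  have h1 : conj (toC (h x₂)) * toC (h x₂) = 1 := conj_mul_toC _
  linear_combination (toC (h x₁) * stairHol U x₁ x₂ * covD c' (cfg U) ψ ⟨x₂, μ⟩) * h1

/-- **THE MODULUS OF THE TRANSPORTED DIFFERENCE IS GAUGE INVARIANT** (`|h(x₁)| = 1`).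
[cite: BalabanImbrieJaffe1985, (2.7) p.303] [cite: Balaban1983RegularityDecay, (1.9) p.573] -/
theorem norm_transportedCovDDiff_gaugeAct (c' : ℝ) (h : GaugeTransf P j U1) (U : GaugeField P j U1) (ψ : Balaban1983to89.Site P j → ℂ)
    (x₁ x₂ : Balaban1983to89.Site P j) (μ : Fin P.d) :
    ‖stairHol (gaugeAct h U) x₁ x₂ * covD c' (cfg (gaugeAct h U)) (fun z => toC (h z) * ψ z) ⟨x₂, μ⟩ -
        covD c' (cfg (gaugeAct h U)) (fun z => toC (h z) * ψ z) ⟨x₁, μ⟩‖ =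
      ‖stairHol U x₁ x₂ * covD c' (cfg U) ψ ⟨x₂, μ⟩ - covD c' (cfg U) ψ ⟨x₁, μ⟩‖ := by
  rw [transportedCovDDiff_gaugeAct, norm_mul, norm_toC, one_mul]

/-- **`G_{k,loc}(u^h)(hf) = h·G_{k,loc}(u)f`** for every cube family of `k`-block unions, every weight family and every cut-off (gen 26's
`gLocT_gaugeAct`: `G_{k,loc}(u^h) = M_hG_{k,loc}(u)M_hᴴ`, and `M_hᴴM_h = 1`). [cite: BalabanImbrieJaffe1988, (2.28) p.263]
[cite: BalabanImbrieJaffe1985, (6.3.2) p.320] -/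
theorem gLocT_gaugeAct_mulVec {ι : Type*} [Fintype ι] {k : ℕ} (hk : j + k ≤ P.m + P.K) {a c : ℝ} (hc : c ≠ 0) (ha : 0 < a)
    (h : GaugeTransf P j U1) (U : GaugeField P j U1) {cube : ι → Finset (Balaban1983to89.Site P j)}
    (hcube : ∀ α, IsBlockUnion k (cube α)) (lam : ι → Balaban1983to89.Site P j → Balaban1983to89.Site P j → ℝ)
    (ζ'' : Balaban1983to89.Site P j → Balaban1983to89.Site P j → ℝ) (f : Balaban1983to89.Site P j → ℂ) :
    gLocT a c (gaugeAct h U) k cube lam ζ'' *ᵥ (fun z => toC (h z) * f z) = fun z => toC (h z) * (gLocT a c U k cube lam ζ'' *ᵥ f) z := by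
  have e1 : (fun z => toC (h z) * f z) = mulOp h *ᵥ f := by funext z; rw [mulOp_mulVec]
  have e2 : (fun z => toC (h z) * (gLocT a c U k cube lam ζ'' *ᵥ f) z) = mulOp h *ᵥ (gLocT a c U k cube lam ζ'' *ᵥ f) := by
    funext z; rw [mulOp_mulVec]
  rw [e1, e2, gLocT_gaugeAct hk hc ha h U hcube lam ζ'', ← mulVec_mulVec, ← mulVec_mulVec, mulVec_mulVec f, conjTranspose_mul_mulOp,
    one_mulVec]

section Data

variable {d : ℕ}

/-- **gen 26's TORUS CUBES `□_α` OF (2.27) ARE UNIONS OF `k`-BLOCKS** (each is a fitting no-wrap box `cubeT` of side multiples of `L^k`,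
`cubeFam_fits`; p31's `isBlockUnion_cubeT`). [cite: BalabanImbrieJaffe1988, (2.27) p.263] -/
theorem isBlockUnion_cubeFam (hPd : P.d = d + 1) {k : ℕ} (hk : k ≤ P.m + P.K) {c M0 : Fin (d + 1) → ℕ} (s W : ℕ) (hM0 : ∀ i, 1 ≤ M0 i)
    (hfit0 : ∀ i, c i * P.L ^ k + P.L ^ k * M0 i ≤ P.sitesPerDir 0) (hN0 : ∀ i, P.L ^ k * M0 i < P.sitesPerDir 0)
    (α : ↥(labels (P.L ^ k) M0 s)) : IsBlockUnion k (cubeFam hPd (P.L ^ k) c M0 s W α) := by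
  obtain ⟨c', M', -, hfit', -, hcα⟩ := cubeFam_fits (hPd := hPd) (s := s) (W := W) hM0 hfit0 hN0 α
  rw [hcα]
  exact isBlockUnion_cubeT hPd hk rfl hfit'

/-- **THE MODULUS OF THE ORDER-`1 + θ` HÖLDER QUANTITY OF `G_{k,loc}(u)` (printed torus data, any cut-off) IS GAUGE INVARIANT**: for every
gauge transformation `h`, every `U(1)` field `u`, every `a_k > 0`, `c′ ≠ 0`, every source `f`, every pair of bonds,
`‖U^h(Γ)(D_{u^h}G_{k,loc}(u^h)(hf))(x₂,μ) − (D_{u^h}G_{k,loc}(u^h)(hf))(x₁,μ)‖ = ‖U(Γ)(D_uG_{k,loc}(u)f)(x₂,μ) − (D_uG_{k,loc}(u)f)(x₁,μ)‖`.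
[cite: BalabanImbrieJaffe1988, (2.30) p.263] [cite: BalabanImbrieJaffe1985, (2.7) p.303] -/
theorem norm_derivHolderQty_gLocT_gaugeAct (hPd : P.d = d + 1) {k : ℕ} (hk : k ≤ P.m + P.K) {a c' : ℝ} (hc : c' ≠ 0) (ha : 0 < a)
    {c M0 : Fin (d + 1) → ℕ} (s W : ℕ) (hM0 : ∀ i, 1 ≤ M0 i) (hfit0 : ∀ i, c i * P.L ^ k + P.L ^ k * M0 i ≤ P.sitesPerDir 0)
    (hN0 : ∀ i, P.L ^ k * M0 i < P.sitesPerDir 0) (ζ : Balaban1983to89.Site P 0 → Balaban1983to89.Site P 0 → ℝ)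
    (h : GaugeTransf P 0 U1) (U : GaugeField P 0 U1) (f : Balaban1983to89.Site P 0 → ℂ) (x₁ x₂ : Balaban1983to89.Site P 0) (μ : Fin P.d) :
    ‖stairHol (gaugeAct h U) x₁ x₂ *
          covD c' (cfg (gaugeAct h U))
            (gLocT a c' (gaugeAct h U) k (cubeFam hPd (P.L ^ k) c M0 s W) (lamFam hPd (P.L ^ k) c M0 s) ζ *ᵥ fun z => toC (h z) * f z)
            ⟨x₂, μ⟩ -
        covD c' (cfg (gaugeAct h U))
            (gLocT a c' (gaugeAct h U) k (cubeFam hPd (P.L ^ k) c M0 s W) (lamFam hPd (P.L ^ k) c M0 s) ζ *ᵥ fun z => toC (h z) * f z)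
            ⟨x₁, μ⟩‖ =
      ‖stairHol U x₁ x₂ * covD c' (cfg U) (gLocT a c' U k (cubeFam hPd (P.L ^ k) c M0 s W) (lamFam hPd (P.L ^ k) c M0 s) ζ *ᵥ f) ⟨x₂, μ⟩ -
        covD c' (cfg U) (gLocT a c' U k (cubeFam hPd (P.L ^ k) c M0 s W) (lamFam hPd (P.L ^ k) c M0 s) ζ *ᵥ f) ⟨x₁, μ⟩‖ := by
  have hk0 : 0 + k ≤ P.m + P.K := by omega
  rw [gLocT_gaugeAct_mulVec hk0 hc ha h U (isBlockUnion_cubeFam hPd hk s W hM0 hfit0 hN0) _ ζ f, norm_transportedCovDDiff_gaugeAct]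

end Data

/-! ## §2 The member of order `1 + θ` of (2.30) for `u` from the bondwise smallness of a GAUGE COPY `u^h` inside `Ω₀` -/

section GaugeCopy

variable {d : ℕ}

open BIJ88LocDerivHolder230SmallFieldTorus (derivHolder230_smallField_of_smooth)

/-- **THE HÖLDER MEMBER OF ORDER `1 + θ` (`0 ≤ θ < 1`) OF (2.30) FOR `u`, FROM THE BONDWISE SMALLNESS OF A GAUGE COPY `u^h`** (p. 263 *"Bounds
analogous to (2.30), (2.31) hold for covariant derivatives and Hölder derivatives of G_{k,loc}(u) of order less than two"* with p. 326's *"by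
change of gauge u_k can be transformed in a local region Λ into a configuration … smooth and small"*): gen 29's
`derivHolder230_smallField_of_smooth` VERBATIM — same `t₀, c₀` depending on `(d, L, a, θ, K₁, K₂)` only, same geometry (`P.d = d+1`, `P.L = L`,
`1 ≤ k ≤ K_P`, no-wrap box `Ω₀` with torus gap `≥ R`, `s ≥ 1`, `W ≥ 2s/3 + R₀/2 + R`, `4L^k + 1 < R`, `0 ≤ R₁ < R₀`, `3L^k ≤ R₀`), same smooth
cut-off hypotheses, same plaquette bound `θ_p` on the torus, same conclusion
`(L^k/|x₁ − x₂|_T)^θ·‖U(Γ_{x₁,x₂})(D_uG_{k,loc}(u)f)(x₂,μ) − (D_uG_{k,loc}(u)f)(x₁,μ)‖ ≤ (L^kε)·c₀·m·(1 + L^k((R₀−R₁)⁻¹ + s⁻¹))²·e^{−t₀D/L^k}·F` for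
`u` — EXCEPT that p27's bondwise `(T, δ)` smallness inside `Ω₀` is asked of the gauge copy `u^h` for an ARBITRARY gauge transformation `h`
(§1: the quantity for `(u^h, hf)` has the modulus of the quantity for `(u, f)`; plaquettes are gauge invariant; `hf` has the size and support of
`f`). [cite: BalabanImbrieJaffe1988, (2.30) p.263] [cite: BalabanImbrieJaffe1985, (2.7) p.303] [cite: Balaban1983RegularityDecay, Theorem p.573 (1.9)] -/
theorem derivHolder230_gaugeCopy_of_smooth (d L : ℕ) (hd1 : 1 ≤ d) (hd3 : d + 1 ≤ 3) (hL : Odd L ∧ 1 < L) {a : ℝ} (ha : 0 < a)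
    {θ : ℝ} (hθ0 : 0 ≤ θ) (hθ1 : θ < 1) {K₁ K₂ : ℝ} (hK₁ : 0 ≤ K₁) (hK₂ : 0 ≤ K₂) :
    ∃ t₀ c₀ : ℝ, 0 < t₀ ∧ 0 < c₀ ∧ ∀ (P : Params) (hPd : P.d = d + 1), P.L = L →
      ∀ k : ℕ, 1 ≤ k → k ≤ P.K → ∀ (c M0 : Fin (d + 1) → ℕ), (∀ i, 1 ≤ M0 i) →
        (∀ i, c i * P.L ^ k + P.L ^ k * M0 i ≤ P.sitesPerDir 0) → (∀ i, P.L ^ k * M0 i < P.sitesPerDir 0) →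
      ∀ (s W : ℕ), 1 ≤ s → ∀ (R R₀ R₁ : ℝ), 4 * (P.L : ℝ) ^ k + 1 < R → 0 ≤ R₁ → R₁ < R₀ → 3 * (P.L : ℝ) ^ k ≤ R₀ →
        2 * (s : ℝ) / 3 + R₀ / 2 + R ≤ W → (∀ i, ((P.L ^ k * M0 i : ℕ) : ℝ) + R ≤ P.sitesPerDir 0) →
      ∀ (ζ : Balaban1983to89.Site P 0 → Balaban1983to89.Site P 0 → ℝ), (∀ x y, |ζ x y| ≤ 1) →
        (∀ x y, R₀ ≤ B5Ineq137Torus.T P 0 x y → ζ x y = 0) →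
        (∀ (x y : Balaban1983to89.Site P 0) (ν : Fin P.d), |ζ (x.shift ν) y - ζ x y| ≤ K₁ / (R₀ - R₁)) →
        (∀ (x y : Balaban1983to89.Site P 0) (κ ν : Fin P.d),
          |ζ ((x.shift ν).shift κ) y - ζ (x.shift ν) y - ζ (x.shift κ) y + ζ x y| ≤ K₂ / (R₀ - R₁) ^ 2) →
      ∀ (U : GaugeField P 0 U1) (h : GaugeTransf P 0 U1) (θp Tu δu : ℝ), 0 ≤ θp →
        (∀ p : Balaban1983to89.Plaq P 0, ‖toC (GaugeField.plaqHol U p) - 1‖ ≤ θp) →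
        2 * (P.d : ℝ) ^ 3 * (((P.L : ℝ) ^ k) ^ 2 * θp) ^ 2 ≤ 1 →
        (∀ b ∈ starB (cubeT hPd (P.L ^ k) c fun i => P.L ^ k * M0 i), blkIter k b.src = blkIter k b.tgt →
          ‖toC (GaugeField.gaugeAct h U b) - 1‖ ≤ Tu) →
        (∀ x ∈ (cubeT hPd (P.L ^ k) c fun i => P.L ^ k * M0 i), ‖holCK (GaugeField.gaugeAct h U) k x - 1‖ ≤ δu) →
        2 * (((P.L : ℝ) ^ k - 1) * (P.L : ℝ) ^ k) * P.d * Tu ^ 2 + 2 * δu ^ 2 ≤ 1 / 2 →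
      ∀ (x₁ x₂ : Balaban1983to89.Site P 0) (μ : Fin P.d),
        x₁ ∈ (cubeT hPd (P.L ^ k) c fun i => P.L ^ k * M0 i) →
        (∀ i, R₀ ≤ (boxCoord hPd (P.L ^ k) c x₁ i : ℝ) ∧ (boxCoord hPd (P.L ^ k) c x₁ i : ℝ) + R₀ ≤ (P.L ^ k * M0 i : ℕ) - 1) →
        x₁.shift μ ∈ (cubeT hPd (P.L ^ k) c fun i => P.L ^ k * M0 i) →
        (∀ i, R₀ ≤ (boxCoord hPd (P.L ^ k) c (x₁.shift μ) i : ℝ) ∧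
          (boxCoord hPd (P.L ^ k) c (x₁.shift μ) i : ℝ) + R₀ ≤ (P.L ^ k * M0 i : ℕ) - 1) →
        x₂ ∈ (cubeT hPd (P.L ^ k) c fun i => P.L ^ k * M0 i) →
        (∀ i, R₀ ≤ (boxCoord hPd (P.L ^ k) c x₂ i : ℝ) ∧ (boxCoord hPd (P.L ^ k) c x₂ i : ℝ) + R₀ ≤ (P.L ^ k * M0 i : ℕ) - 1) →
        x₂.shift μ ∈ (cubeT hPd (P.L ^ k) c fun i => P.L ^ k * M0 i) →
        (∀ i, R₀ ≤ (boxCoord hPd (P.L ^ k) c (x₂.shift μ) i : ℝ) ∧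
          (boxCoord hPd (P.L ^ k) c (x₂.shift μ) i : ℝ) + R₀ ≤ (P.L ^ k * M0 i : ℕ) - 1) →
      ∀ (f : Balaban1983to89.Site P 0 → ℂ) (F D : ℝ), (∀ y, ‖f y‖ ≤ F) → 0 ≤ D →
        (∀ y, f y ≠ 0 → D ≤ B5Ineq137Torus.T P 0 x₁ y) → (∀ y, f y ≠ 0 → D ≤ B5Ineq137Torus.T P 0 x₂ y) →
        ((P.L : ℝ) ^ k / B5Ineq137Torus.T P 0 x₁ x₂) ^ θ *
          ‖stairHol U x₁ x₂ *
              covD P.eps⁻¹ (cfg U)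
                (gLocT (B1RG242Torus.α P a k * (P.L : ℝ) ^ (k * P.d)) P.eps⁻¹ U k
                  (cubeFam hPd (P.L ^ k) c M0 s W) (lamFam hPd (P.L ^ k) c M0 s) ζ *ᵥ f) ⟨x₂, μ⟩ -
            covD P.eps⁻¹ (cfg U)
                (gLocT (B1RG242Torus.α P a k * (P.L : ℝ) ^ (k * P.d)) P.eps⁻¹ U k
                  (cubeFam hPd (P.L ^ k) c M0 s W) (lamFam hPd (P.L ^ k) c M0 s) ζ *ᵥ f) ⟨x₁, μ⟩‖ ≤
          P.spacing k * (c₀ * (⌊(((P.L : ℝ) ^ k) - 1 + R₀) / s⌋₊ + 3) ^ (d + 1) *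
            (1 + (P.L : ℝ) ^ k * ((R₀ - R₁)⁻¹ + (s : ℝ)⁻¹)) ^ 2 * Real.exp (-(t₀ * (((P.L : ℝ) ^ k)⁻¹ * D))) * F) := by
  obtain ⟨t₀, c₀, ht₀, hc₀, H⟩ := derivHolder230_smallField_of_smooth d L hd1 hd3 hL ha hθ0 hθ1 hK₁ hK₂
  refine ⟨t₀, c₀, ht₀, hc₀, ?_⟩
  intro P hPd hPL k hk1 hkK c M0 hM0 hfit0 hN0 s W hs R R₀ R₁ hR hR₁ hR10 hLR₀ hW hgap ζ hζabs hζ0 hζ1 hζ2 U h θp Tu δu hθp0 hplaq hθps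
    hInt hTree hsmall x₁ x₂ μ hx₁ hdeep₁ hx₁e hdeep₁e hx₂ hdeep₂ hx₂e hdeep₂e f F D hF hD hsupp₁ hsupp₂
  have hk : k ≤ P.m + P.K := hkK.trans (Nat.le_add_left _ _)
  have hA0 : 0 < B1RG242Torus.α P a k * (P.L : ℝ) ^ (k * P.d) :=
    mul_pos (mul_pos (B1.aSeq_pos ha (B1RG242Torus.one_lt_cast_L P) hk1) (inv_pos.mpr (pow_pos (P.spacing_pos k) 2)))
      (pow_pos P.cast_L_pos _)
  have hc' : P.eps⁻¹ ≠ 0 := inv_ne_zero P.eps_pos.ne'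
  -- the plaquettes of the gauge copy are those of `u`
  have hplaq' : ∀ p : Balaban1983to89.Plaq P 0, ‖toC (GaugeField.plaqHol (GaugeField.gaugeAct h U) p) - 1‖ ≤ θp := fun p => by
    rw [norm_toC_plaqHol_gaugeAct_sub_one]; exact hplaq p
  -- the rotated source `hf` has the size and support of `f`
  have hF' : ∀ y, ‖(fun z => toC (h z) * f z) y‖ ≤ F := fun y => by
    show ‖toC (h y) * f y‖ ≤ F
    rw [norm_mul, norm_toC, one_mul]; exact hF y
  have hsupp₁' : ∀ y, (fun z => toC (h z) * f z) y ≠ 0 → D ≤ B5Ineq137Torus.T P 0 x₁ y := fun y hy =>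
    hsupp₁ y (right_ne_zero_of_mul hy)
  have hsupp₂' : ∀ y, (fun z => toC (h z) * f z) y ≠ 0 → D ≤ B5Ineq137Torus.T P 0 x₂ y := fun y hy =>
    hsupp₂ y (right_ne_zero_of_mul hy)
  -- gen 29's member for the gauge copy and the rotated source
  have hmain := H P hPd hPL k hk1 hkK c M0 hM0 hfit0 hN0 s W hs R R₀ R₁ hR hR₁ hR10 hLR₀ hW hgap ζ hζabs hζ0 hζ1 hζ2
    (GaugeField.gaugeAct h U) θp Tu δu hθp0 hplaq' hθps hInt hTree hsmall x₁ x₂ μ hx₁ hdeep₁ hx₁e hdeep₁e hx₂ hdeep₂ hx₂e hdeep₂e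
    (fun z => toC (h z) * f z) F D hF' hD hsupp₁' hsupp₂'
  rw [norm_derivHolderQty_gLocT_gaugeAct hPd hk hc' hA0 s W hM0 hfit0 hN0 ζ h U f x₁ x₂ μ] at hmain
  exact hmain

end GaugeCopy

/-! ## §3 The member of order `1 + θ` of (2.30) under the PRINTED plaquette smallness (7.3.1) ALONE — thresholds from `(d, L^k)` only -/

section Plaquette

variable {d : ℕ}

/-- **THE HÖLDER MEMBER OF ORDER `1 + θ` (`0 ≤ θ < 1`) OF (2.30) AT NON-FLAT SMALL FIELDS UNDER THE PRINTED PLAQUETTE SMALLNESS ALONE, FOR THE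
TORUS CUBES AND WEIGHTS OF RECORD AND A SMOOTH CUT-OFF** (p. 263: *"We assume that u is smooth in the □_α's entering the sum in (2.27) …
Bounds analogous to (2.30), (2.31) hold for covariant derivatives and Hölder derivatives of G_{k,loc}(u) of order less than two"*;
[BalabanImbrieJaffe1985] (7.3.1): *"|v(∂p) − 1| ≦ e_kμ(e_k)"* — here a fine-plaquette bound `|u(∂p) − 1| ≤ θ_p` on the torus with
`2(d+1)³(L^{2k}θ_p)² ≤ 1` and a block-scale `T ≥ d(L^k − 1)θ_p` with `2(L^k−1)L^k(d+1)T² + 2((d+1)(L^k−1)T)² ≤ 1/2`, NO gauge condition on `u`).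
For `d + 1 ∈ {2,3}`, `L` odd `> 1`, `a > 0`, `0 ≤ θ < 1` and moduli `K₁, K₂ ≥ 0` THERE EXIST `t₀, c₀ > 0` depending on `(d, L, a, θ, K₁, K₂)`
only such that for every volume (`P.d = d+1`, `P.L = L`), every `1 ≤ k ≤ K_P` with `2(L^k − 1) + 4 < |T|`, every no-wrap box
`Ω₀ = c·L^k + Π_i[0, L^kM₀_i)` shorter than the torus leaving a torus gap `≥ R`, cube spacing `s ≥ 1`, half-width `W ≥ 2s/3 + R₀/2 + R`, radii
`4L^k + 1 < R`, `0 ≤ R₁ < R₀`, `3L^k ≤ R₀`, EVERY real cut-off `ζ″` with `|ζ″| ≤ 1`, `= 0` beyond `R₀`, first lattice differences in `x` bounded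
by `K₁/(R₀−R₁)` and second ones by `K₂/(R₀−R₁)²`, every `U(1)` field `u` with `|u(∂p) − 1| ≤ θ_p` for all fine plaquettes,
`2(d+1)³(L^{2k}θ_p)² ≤ 1`, every `T ≥ d(L^k − 1)θ_p` with `2(L^k−1)L^k(d+1)T² + 2((d+1)(L^k−1)T)² ≤ 1/2`, every direction `μ`, all bonds
`⟨x₁, x₁+e_μ⟩`, `⟨x₂, x₂+e_μ⟩` with their four end points in `Ω₀` at chart depth `≥ R₀`, and every `f` (`‖f‖_∞ ≤ F`) supported at sup-torus
distance `≥ D ≥ 0` from `x₁` and from `x₂`: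
`(L^k/|x₁ − x₂|_T)^θ·‖U(Γ_{x₁,x₂})(D_uG_{k,loc}(u)f)(x₂, μ) − (D_uG_{k,loc}(u)f)(x₁, μ)‖ ≤ (L^kε)·c₀·m·(1 + L^k((R₀ − R₁)⁻¹ + s⁻¹))²·e^{−t₀D/L^k}·F`,
`m = (⌊(L^k − 1 + R₀)/s⌋ + 3)^{d+1}`, `U(Γ_{x₁,x₂})` = p30's `stairHol u x₁ x₂` — §2 with p34's blockwise centred gauge `smallField_blockGauge`
(`u^h` is `T`-small on the intra-block bonds and its block holonomies are within `(d+1)(L^k − 1)T` of `1`, everywhere on the torus).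
[cite: BalabanImbrieJaffe1988, (2.30) p.263] [cite: BalabanImbrieJaffe1985, (7.3.1) p.326] [cite: Balaban1983RegularityDecay, Theorem p.573 (1.9)] -/
theorem derivHolder230_smallPlaquette_of_smooth (d L : ℕ) (hd1 : 1 ≤ d) (hd3 : d + 1 ≤ 3) (hL : Odd L ∧ 1 < L) {a : ℝ} (ha : 0 < a)
    {θ : ℝ} (hθ0 : 0 ≤ θ) (hθ1 : θ < 1) {K₁ K₂ : ℝ} (hK₁ : 0 ≤ K₁) (hK₂ : 0 ≤ K₂) :
    ∃ t₀ c₀ : ℝ, 0 < t₀ ∧ 0 < c₀ ∧ ∀ (P : Params) (hPd : P.d = d + 1), P.L = L →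
      ∀ k : ℕ, 1 ≤ k → k ≤ P.K → 2 * (P.L ^ k - 1) + 4 < P.sitesPerDir 0 → ∀ (c M0 : Fin (d + 1) → ℕ), (∀ i, 1 ≤ M0 i) →
        (∀ i, c i * P.L ^ k + P.L ^ k * M0 i ≤ P.sitesPerDir 0) → (∀ i, P.L ^ k * M0 i < P.sitesPerDir 0) →
      ∀ (s W : ℕ), 1 ≤ s → ∀ (R R₀ R₁ : ℝ), 4 * (P.L : ℝ) ^ k + 1 < R → 0 ≤ R₁ → R₁ < R₀ → 3 * (P.L : ℝ) ^ k ≤ R₀ →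
        2 * (s : ℝ) / 3 + R₀ / 2 + R ≤ W → (∀ i, ((P.L ^ k * M0 i : ℕ) : ℝ) + R ≤ P.sitesPerDir 0) →
      ∀ (ζ : Balaban1983to89.Site P 0 → Balaban1983to89.Site P 0 → ℝ), (∀ x y, |ζ x y| ≤ 1) →
        (∀ x y, R₀ ≤ B5Ineq137Torus.T P 0 x y → ζ x y = 0) →
        (∀ (x y : Balaban1983to89.Site P 0) (ν : Fin P.d), |ζ (x.shift ν) y - ζ x y| ≤ K₁ / (R₀ - R₁)) →
        (∀ (x y : Balaban1983to89.Site P 0) (κ ν : Fin P.d),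
          |ζ ((x.shift ν).shift κ) y - ζ (x.shift ν) y - ζ (x.shift κ) y + ζ x y| ≤ K₂ / (R₀ - R₁) ^ 2) →
      ∀ (U : GaugeField P 0 U1) (θp : ℝ), 0 ≤ θp →
        (∀ p : Balaban1983to89.Plaq P 0, ‖toC (GaugeField.plaqHol U p) - 1‖ ≤ θp) →
        2 * (P.d : ℝ) ^ 3 * (((P.L : ℝ) ^ k) ^ 2 * θp) ^ 2 ≤ 1 →
      ∀ (T : ℝ), ((P.d - 1 : ℕ) : ℝ) * ((P.L : ℝ) ^ k - 1) * θp ≤ T →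
        2 * (((P.L : ℝ) ^ k - 1) * (P.L : ℝ) ^ k) * P.d * T ^ 2 + 2 * (P.d * ((P.L : ℝ) ^ k - 1) * T) ^ 2 ≤ 1 / 2 →
      ∀ (x₁ x₂ : Balaban1983to89.Site P 0) (μ : Fin P.d),
        x₁ ∈ (cubeT hPd (P.L ^ k) c fun i => P.L ^ k * M0 i) →
        (∀ i, R₀ ≤ (boxCoord hPd (P.L ^ k) c x₁ i : ℝ) ∧ (boxCoord hPd (P.L ^ k) c x₁ i : ℝ) + R₀ ≤ (P.L ^ k * M0 i : ℕ) - 1) →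
        x₁.shift μ ∈ (cubeT hPd (P.L ^ k) c fun i => P.L ^ k * M0 i) →
        (∀ i, R₀ ≤ (boxCoord hPd (P.L ^ k) c (x₁.shift μ) i : ℝ) ∧
          (boxCoord hPd (P.L ^ k) c (x₁.shift μ) i : ℝ) + R₀ ≤ (P.L ^ k * M0 i : ℕ) - 1) →
        x₂ ∈ (cubeT hPd (P.L ^ k) c fun i => P.L ^ k * M0 i) →
        (∀ i, R₀ ≤ (boxCoord hPd (P.L ^ k) c x₂ i : ℝ) ∧ (boxCoord hPd (P.L ^ k) c x₂ i : ℝ) + R₀ ≤ (P.L ^ k * M0 i : ℕ) - 1) →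
        x₂.shift μ ∈ (cubeT hPd (P.L ^ k) c fun i => P.L ^ k * M0 i) →
        (∀ i, R₀ ≤ (boxCoord hPd (P.L ^ k) c (x₂.shift μ) i : ℝ) ∧
          (boxCoord hPd (P.L ^ k) c (x₂.shift μ) i : ℝ) + R₀ ≤ (P.L ^ k * M0 i : ℕ) - 1) →
      ∀ (f : Balaban1983to89.Site P 0 → ℂ) (F D : ℝ), (∀ y, ‖f y‖ ≤ F) → 0 ≤ D →
        (∀ y, f y ≠ 0 → D ≤ B5Ineq137Torus.T P 0 x₁ y) → (∀ y, f y ≠ 0 → D ≤ B5Ineq137Torus.T P 0 x₂ y) →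
        ((P.L : ℝ) ^ k / B5Ineq137Torus.T P 0 x₁ x₂) ^ θ *
          ‖stairHol U x₁ x₂ *
              covD P.eps⁻¹ (cfg U)
                (gLocT (B1RG242Torus.α P a k * (P.L : ℝ) ^ (k * P.d)) P.eps⁻¹ U k
                  (cubeFam hPd (P.L ^ k) c M0 s W) (lamFam hPd (P.L ^ k) c M0 s) ζ *ᵥ f) ⟨x₂, μ⟩ -
            covD P.eps⁻¹ (cfg U)
                (gLocT (B1RG242Torus.α P a k * (P.L : ℝ) ^ (k * P.d)) P.eps⁻¹ U k
                  (cubeFam hPd (P.L ^ k) c M0 s W) (lamFam hPd (P.L ^ k) c M0 s) ζ *ᵥ f) ⟨x₁, μ⟩‖ ≤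
          P.spacing k * (c₀ * (⌊(((P.L : ℝ) ^ k) - 1 + R₀) / s⌋₊ + 3) ^ (d + 1) *
            (1 + (P.L : ℝ) ^ k * ((R₀ - R₁)⁻¹ + (s : ℝ)⁻¹)) ^ 2 * Real.exp (-(t₀ * (((P.L : ℝ) ^ k)⁻¹ * D))) * F) := by
  obtain ⟨t₀, c₀, ht₀, hc₀, H⟩ := derivHolder230_gaugeCopy_of_smooth d L hd1 hd3 hL ha hθ0 hθ1 hK₁ hK₂
  refine ⟨t₀, c₀, ht₀, hc₀, ?_⟩
  intro P hPd hPL k hk1 hkK hRsz c M0 hM0 hfit0 hN0 s W hs R R₀ R₁ hR hR₁ hR10 hLR₀ hW hgap ζ hζabs hζ0 hζ1 hζ2 U θp hθp0 hplaq hθps T hT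
    hsmallT x₁ x₂ μ hx₁ hdeep₁ hx₁e hdeep₁e hx₂ hdeep₂ hx₂e hdeep₂e f F D hF hD hsupp₁ hsupp₂
  have hk0 : 0 + k ≤ P.m + P.K := by omega
  -- p34's blockwise centred gauge supplies the bondwise hypotheses of §2 for the gauge copy, everywhere on the torus
  obtain ⟨hInt, hTree⟩ := smallField_blockGauge (j := 0) hk0 U hθp0 hplaq hRsz hT
  exact H P hPd hPL k hk1 hkK c M0 hM0 hfit0 hN0 s W hs R R₀ R₁ hR hR₁ hR10 hLR₀ hW hgap ζ hζabs hζ0 hζ1 hζ2 U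
    (fun z => centredGauge U (cornerIter k (blkIter k z)) (P.L ^ k - 1) z) θp T (P.d * ((P.L : ℝ) ^ k - 1) * T) hθp0 hplaq hθps
    (fun b _ hbb => hInt b hbb) (fun y _ => hTree y) hsmallT x₁ x₂ μ hx₁ hdeep₁ hx₁e hdeep₁e hx₂ hdeep₂ hx₂e hdeep₂e f F D hF hD hsupp₁ hsupp₂

end Plaquette

/-! ## §4 The member for the smooth product cut-off `ζ″ = ζ^Π(R₁, R₀)` of (2.29) under the plaquette smallness alone -/

section ZetaPiMember

open BIJ88LocDeriv230ZetaPiFlatTorus (zetaPi_zero_eq_zero_of_le abs_zetaPi_zero_le_one abs_zetaPi_zero_shift_sub_le abs_zetaPi_zero_secondDiff_le)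
open BIJ88HkLocHolderTorus (zetaPi secondDiffConst)
open Literature.Analysis.Calculus (exists_abs_deriv_and_deriv_deriv_smoothTransition_le)

variable {d : ℕ}

/-- **THE HÖLDER MEMBER OF ORDER `1 + θ` OF (2.30) UNDER THE PLAQUETTE SMALLNESS ALONE, FOR `G_{k,loc}(u)` BUILT FROM THE TORUS CUBES AND
WEIGHTS OF RECORD AND THE SMOOTH PRODUCT CUT-OFF `ζ″ = ζ^Π(R₁, R₀)`** (print p. 263: *"ζ_k(x₁, x₂) is a smooth function of x₁ − x₂"*, *"Bounds
analogous to (2.30) … hold for covariant derivatives and Hölder derivatives of G_{k,loc}(u) of order less than two"*; [BalabanImbrieJaffe1985]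
(7.3.1)): for `d + 1 ∈ {2,3}`, `L` odd `> 1`, `a > 0` and every `0 ≤ θ < 1` THERE EXIST `t₀, c₀ > 0` depending on `(d, L, a, θ)` and the universal
profile bound `C_σ` only such that, for all data as in `derivHolder230_smallPlaquette_of_smooth` with `1 ≤ R₁ < R₀ ≤ (|T^{(0)}| − 3)/2`,
`(L^k/|x₁ − x₂|_T)^θ·‖U(Γ_{x₁,x₂})(D_uG_{k,loc}(u)f)(x₂, μ) − (D_uG_{k,loc}(u)f)(x₁, μ)‖ ≤ (L^kε)·c₀·m·(1 + L^k((R₀ − R₁)⁻¹ + s⁻¹))²·e^{−t₀D/L^k}·F`.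
[cite: BalabanImbrieJaffe1988, (2.30) p.263] [cite: BalabanImbrieJaffe1985, (7.3.1) p.326] [cite: Balaban1983RegularityDecay, Theorem p.573 (1.9)] -/
theorem derivHolder230_smallPlaquette_zetaPi (d L : ℕ) (hd1 : 1 ≤ d) (hd3 : d + 1 ≤ 3) (hL : Odd L ∧ 1 < L) {a : ℝ} (ha : 0 < a)
    {θ : ℝ} (hθ0 : 0 ≤ θ) (hθ1 : θ < 1) :
    ∃ t₀ c₀ : ℝ, 0 < t₀ ∧ 0 < c₀ ∧ ∀ (P : Params) (hPd : P.d = d + 1), P.L = L →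
      ∀ k : ℕ, 1 ≤ k → k ≤ P.K → 2 * (P.L ^ k - 1) + 4 < P.sitesPerDir 0 → ∀ (c M0 : Fin (d + 1) → ℕ), (∀ i, 1 ≤ M0 i) →
        (∀ i, c i * P.L ^ k + P.L ^ k * M0 i ≤ P.sitesPerDir 0) → (∀ i, P.L ^ k * M0 i < P.sitesPerDir 0) →
      ∀ (s W : ℕ), 1 ≤ s → ∀ (R R₀ R₁ : ℝ), 4 * (P.L : ℝ) ^ k + 1 < R → 1 ≤ R₁ → R₁ < R₀ → R₀ ≤ ((P.sitesPerDir 0 : ℝ) - 3) / 2 →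
        3 * (P.L : ℝ) ^ k ≤ R₀ → 2 * (s : ℝ) / 3 + R₀ / 2 + R ≤ W → (∀ i, ((P.L ^ k * M0 i : ℕ) : ℝ) + R ≤ P.sitesPerDir 0) →
      ∀ (U : GaugeField P 0 U1) (θp : ℝ), 0 ≤ θp →
        (∀ p : Balaban1983to89.Plaq P 0, ‖toC (GaugeField.plaqHol U p) - 1‖ ≤ θp) →
        2 * (P.d : ℝ) ^ 3 * (((P.L : ℝ) ^ k) ^ 2 * θp) ^ 2 ≤ 1 →
      ∀ (T : ℝ), ((P.d - 1 : ℕ) : ℝ) * ((P.L : ℝ) ^ k - 1) * θp ≤ T →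
        2 * (((P.L : ℝ) ^ k - 1) * (P.L : ℝ) ^ k) * P.d * T ^ 2 + 2 * (P.d * ((P.L : ℝ) ^ k - 1) * T) ^ 2 ≤ 1 / 2 →
      ∀ (x₁ x₂ : Balaban1983to89.Site P 0) (μ : Fin P.d),
        x₁ ∈ (cubeT hPd (P.L ^ k) c fun i => P.L ^ k * M0 i) →
        (∀ i, R₀ ≤ (boxCoord hPd (P.L ^ k) c x₁ i : ℝ) ∧ (boxCoord hPd (P.L ^ k) c x₁ i : ℝ) + R₀ ≤ (P.L ^ k * M0 i : ℕ) - 1) →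
        x₁.shift μ ∈ (cubeT hPd (P.L ^ k) c fun i => P.L ^ k * M0 i) →
        (∀ i, R₀ ≤ (boxCoord hPd (P.L ^ k) c (x₁.shift μ) i : ℝ) ∧
          (boxCoord hPd (P.L ^ k) c (x₁.shift μ) i : ℝ) + R₀ ≤ (P.L ^ k * M0 i : ℕ) - 1) →
        x₂ ∈ (cubeT hPd (P.L ^ k) c fun i => P.L ^ k * M0 i) →
        (∀ i, R₀ ≤ (boxCoord hPd (P.L ^ k) c x₂ i : ℝ) ∧ (boxCoord hPd (P.L ^ k) c x₂ i : ℝ) + R₀ ≤ (P.L ^ k * M0 i : ℕ) - 1) →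
        x₂.shift μ ∈ (cubeT hPd (P.L ^ k) c fun i => P.L ^ k * M0 i) →
        (∀ i, R₀ ≤ (boxCoord hPd (P.L ^ k) c (x₂.shift μ) i : ℝ) ∧
          (boxCoord hPd (P.L ^ k) c (x₂.shift μ) i : ℝ) + R₀ ≤ (P.L ^ k * M0 i : ℕ) - 1) →
      ∀ (f : Balaban1983to89.Site P 0 → ℂ) (F D : ℝ), (∀ y, ‖f y‖ ≤ F) → 0 ≤ D →
        (∀ y, f y ≠ 0 → D ≤ B5Ineq137Torus.T P 0 x₁ y) → (∀ y, f y ≠ 0 → D ≤ B5Ineq137Torus.T P 0 x₂ y) →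
        ((P.L : ℝ) ^ k / B5Ineq137Torus.T P 0 x₁ x₂) ^ θ *
          ‖stairHol U x₁ x₂ *
              covD P.eps⁻¹ (cfg U)
                (gLocT (B1RG242Torus.α P a k * (P.L : ℝ) ^ (k * P.d)) P.eps⁻¹ U k
                  (cubeFam hPd (P.L ^ k) c M0 s W) (lamFam hPd (P.L ^ k) c M0 s) (zetaPi R₁ R₀ 0) *ᵥ f) ⟨x₂, μ⟩ -
            covD P.eps⁻¹ (cfg U)
                (gLocT (B1RG242Torus.α P a k * (P.L : ℝ) ^ (k * P.d)) P.eps⁻¹ U k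
                  (cubeFam hPd (P.L ^ k) c M0 s W) (lamFam hPd (P.L ^ k) c M0 s) (zetaPi R₁ R₀ 0) *ᵥ f) ⟨x₁, μ⟩‖ ≤
          P.spacing k * (c₀ * (⌊(((P.L : ℝ) ^ k) - 1 + R₀) / s⌋₊ + 3) ^ (d + 1) *
            (1 + (P.L : ℝ) ^ k * ((R₀ - R₁)⁻¹ + (s : ℝ)⁻¹)) ^ 2 * Real.exp (-(t₀ * (((P.L : ℝ) ^ k)⁻¹ * D))) * F) := by
  obtain ⟨C, hC0, hC1, hC2⟩ := exists_abs_deriv_and_deriv_deriv_smoothTransition_le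
  have hK₂ : 0 ≤ C ^ 2 + C := by positivity
  obtain ⟨t₀, c₀, ht₀, hc₀, H⟩ := derivHolder230_smallPlaquette_of_smooth d L hd1 hd3 hL ha hθ0 hθ1 hC0 hK₂
  refine ⟨t₀, c₀, ht₀, hc₀, ?_⟩
  intro P hPd hPL k hk1 hkK hRsz c M0 hM0 hfit0 hN0 s W hs R R₀ R₁ hR hR₁ hR10 hR₀N hLR₀ hW hgap U θp hθp0 hplaq hθps T hT hsmallT
    x₁ x₂ μ hx₁ hdeep₁ hx₁e hdeep₁e hx₂ hdeep₂ hx₂e hdeep₂e f F D hF hD hsupp₁ hsupp₂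
  have e : secondDiffConst C R₁ R₀ = (C ^ 2 + C) / (R₀ - R₁) ^ 2 := by rw [secondDiffConst, div_pow, add_div]
  exact H P hPd hPL k hk1 hkK hRsz c M0 hM0 hfit0 hN0 s W hs R R₀ R₁ hR (zero_le_one.trans hR₁) hR10 hLR₀ hW hgap (zetaPi R₁ R₀ 0)
    (abs_zetaPi_zero_le_one R₁ R₀) (zetaPi_zero_eq_zero_of_le hR10) (abs_zetaPi_zero_shift_sub_le hC1 hR10)
    (fun x y κ ν => (abs_zetaPi_zero_secondDiff_le hC1 hC2 hR10 hR₁ hR₀N x y κ ν).trans_eq e)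
    U θp hθp0 hplaq hθps T hT hsmallT x₁ x₂ μ hx₁ hdeep₁ hx₁e hdeep₁e hx₂ hdeep₂ hx₂e hdeep₂e f F D hF hD hsupp₁ hsupp₂

end ZetaPiMember

/-! ## §5 (v1.1) Non-vacuity: every hypothesis of `derivHolder230_smallPlaquette_zetaPi` met at once on a genuine two-dimensional `Setup.Params` torus -/

section Instance

open B4Reflection242 (boxDom mem_boxDom)
open BIJ88NeumannPropagatorFlatDecayCube (cubePt cubePt_mem_cubeT boxCoord_cubePt cubePt_add_single)
open BIJ88HkLocHolderTorus (zetaPi)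

/-- The parameters of the instance: `d = 2` directions (`P.d = 1 + 1`), `L = 3`, `m = 1`, `K = 3` — `2·3⁴ = 162` fine sites per direction (the
torus of gen 29's Op-file instance `deriv230_smallPlaquette_op_cwt_instance`). [cite: Balaban1987RG1, (0.1) p.251] -/
private abbrev P2 : Params := { d := 2, L := 3, m := 1, K := 3, hd := by norm_num, hL := ⟨⟨1, rfl⟩, by norm_num⟩ }

/-- `|T^{(0)}| = 162` per direction. [cite: Balaban1987RG1, (0.1) p.251] -/
private theorem sites_P2 : P2.sitesPerDir 0 = 162 := by decide

/-- **THE HYPOTHESES OF `derivHolder230_smallPlaquette_zetaPi` ARE JOINTLY SATISFIABLE** (the order-`1 + θ` member under the plaquette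
smallness alone is not a statement about the empty set): on the two-dimensional `Setup` torus `(ℤ/162)²` (`d + 1 = 2`, `L = 3` odd), at `k = 1`
(`2(L^k − 1) + 4 = 8 < 162`), Hölder exponent `θ = 1/2`, box `Ω₀ = [0, 24)²` (`c = 0`, `M₀ = 8`), cube spacing `s = 1`, half-width `W = 20`, radii
`R = 14 > 4L^k + 1`, `R₁ = 1`, `R₀ = 9 = 3L^k ≤ (162 − 3)/2`, `W ≥ 2s/3 + R₀/2 + R`, torus gap `24 + 14 ≤ 162`, the trivial field `u = 1` (all
plaquette variables `= 1`: `θ_p = 0`, `T = 0`), the bonds `⟨(12,12), (13,12)⟩` and `⟨(13,12), (14,12)⟩` (all four ends at chart depth `≥ 9`):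
every displayed hypothesis holds; consequently the order-`3/2` Hölder bound applies there for every source `f`.
[cite: BalabanImbrieJaffe1988, (2.30) p.263] -/
theorem derivHolder230_smallPlaquette_zetaPi_instance :
    ∃ t₀ c₀ : ℝ, 0 < t₀ ∧ 0 < c₀ ∧ ∀ (f : Balaban1983to89.Site P2 0 → ℂ) (F D : ℝ), (∀ y, ‖f y‖ ≤ F) → 0 ≤ D →
      (∀ y, f y ≠ 0 → D ≤ B5Ineq137Torus.T P2 0 (cubePt (d := 1) rfl (P2.L ^ 1) (fun _ => 0) ![12, 12]) y) →
      (∀ y, f y ≠ 0 → D ≤ B5Ineq137Torus.T P2 0 (cubePt (d := 1) rfl (P2.L ^ 1) (fun _ => 0) ![13, 12]) y) →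
      ((P2.L : ℝ) ^ 1 /
            B5Ineq137Torus.T P2 0 (cubePt (d := 1) rfl (P2.L ^ 1) (fun _ => 0) ![12, 12])
              (cubePt (d := 1) rfl (P2.L ^ 1) (fun _ => 0) ![13, 12])) ^ (1 / 2 : ℝ) *
        ‖stairHol (1 : GaugeField P2 0 U1) (cubePt (d := 1) rfl (P2.L ^ 1) (fun _ => 0) ![12, 12])
              (cubePt (d := 1) rfl (P2.L ^ 1) (fun _ => 0) ![13, 12]) *
            covD P2.eps⁻¹ (cfg (1 : GaugeField P2 0 U1))
              (gLocT (B1RG242Torus.α P2 1 1 * (P2.L : ℝ) ^ (1 * P2.d)) P2.eps⁻¹ (1 : GaugeField P2 0 U1) 1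
                (cubeFam (d := 1) rfl (P2.L ^ 1) (fun _ => 0) (fun _ => 8) 1 20) (lamFam (d := 1) rfl (P2.L ^ 1) (fun _ => 0) (fun _ => 8) 1)
                (zetaPi 1 9 0) *ᵥ f)
              ⟨cubePt (d := 1) rfl (P2.L ^ 1) (fun _ => 0) ![13, 12], Fin.cast (rfl : P2.d = 1 + 1).symm 0⟩ -
          covD P2.eps⁻¹ (cfg (1 : GaugeField P2 0 U1))
              (gLocT (B1RG242Torus.α P2 1 1 * (P2.L : ℝ) ^ (1 * P2.d)) P2.eps⁻¹ (1 : GaugeField P2 0 U1) 1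
                (cubeFam (d := 1) rfl (P2.L ^ 1) (fun _ => 0) (fun _ => 8) 1 20) (lamFam (d := 1) rfl (P2.L ^ 1) (fun _ => 0) (fun _ => 8) 1)
                (zetaPi 1 9 0) *ᵥ f)
              ⟨cubePt (d := 1) rfl (P2.L ^ 1) (fun _ => 0) ![12, 12], Fin.cast (rfl : P2.d = 1 + 1).symm 0⟩‖ ≤
        P2.spacing 1 * (c₀ * (⌊(((P2.L : ℝ) ^ 1) - 1 + 9) / (1 : ℕ)⌋₊ + 3) ^ (1 + 1) *
          (1 + (P2.L : ℝ) ^ 1 * ((9 - 1 : ℝ)⁻¹ + ((1 : ℕ) : ℝ)⁻¹)) ^ 2 * Real.exp (-(t₀ * (((P2.L : ℝ) ^ 1)⁻¹ * D))) * F) := by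
  obtain ⟨t₀, c₀, ht₀, hc₀, H⟩ := derivHolder230_smallPlaquette_zetaPi 1 3 le_rfl (by norm_num) ⟨⟨1, rfl⟩, by norm_num⟩ one_pos
    (θ := 1 / 2) (by norm_num) (by norm_num)
  refine ⟨t₀, c₀, ht₀, hc₀, fun f F D hF hD hsupp₁ hsupp₂ => ?_⟩
  have hfit : ∀ i : Fin (1 + 1), (fun _ => 0 : Fin (1 + 1) → ℕ) i * P2.L ^ 1 + P2.L ^ 1 * (fun _ => 8 : Fin (1 + 1) → ℕ) i ≤ P2.sitesPerDir 0 :=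
    fun _ => by rw [sites_P2]; norm_num
  have hN0 : ∀ i : Fin (1 + 1), P2.L ^ 1 * (fun _ => 8 : Fin (1 + 1) → ℕ) i < P2.sitesPerDir 0 := fun _ => by rw [sites_P2]; norm_num
  have hgap : ∀ i : Fin (1 + 1), ((P2.L ^ 1 * (fun _ => 8 : Fin (1 + 1) → ℕ) i : ℕ) : ℝ) + 14 ≤ P2.sitesPerDir 0 := fun _ => by
    rw [sites_P2]; norm_num
  have hsz : 2 * (P2.L ^ 1 - 1) + 4 < P2.sitesPerDir 0 := by rw [sites_P2]; norm_num
  have hR₀N : (9 : ℝ) ≤ ((P2.sitesPerDir 0 : ℝ) - 3) / 2 := by rw [sites_P2]; norm_num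
  -- the bond ends in the chart
  have hz12 : (![12, 12] : Fin (1 + 1) → ℤ) ∈ boxDom (fun i : Fin (1 + 1) => P2.L ^ 1 * (fun _ => 8 : Fin (1 + 1) → ℕ) i) := by
    rw [mem_boxDom]; intro i; fin_cases i <;> norm_num
  have hz13 : (![13, 12] : Fin (1 + 1) → ℤ) ∈ boxDom (fun i : Fin (1 + 1) => P2.L ^ 1 * (fun _ => 8 : Fin (1 + 1) → ℕ) i) := by
    rw [mem_boxDom]; intro i; fin_cases i <;> norm_num
  have hz14 : (![14, 12] : Fin (1 + 1) → ℤ) ∈ boxDom (fun i : Fin (1 + 1) => P2.L ^ 1 * (fun _ => 8 : Fin (1 + 1) → ℕ) i) := by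
    rw [mem_boxDom]; intro i; fin_cases i <;> norm_num
  have hshift12 : (cubePt (d := 1) rfl (P2.L ^ 1) (fun _ => 0) ![12, 12]).shift (Fin.cast (rfl : P2.d = 1 + 1).symm 0) =
      cubePt (d := 1) rfl (P2.L ^ 1) (fun _ => 0) ![13, 12] := by
    rw [← cubePt_add_single]
    congr 1
    funext j
    fin_cases j <;> simp
  have hshift13 : (cubePt (d := 1) rfl (P2.L ^ 1) (fun _ => 0) ![13, 12]).shift (Fin.cast (rfl : P2.d = 1 + 1).symm 0) =
      cubePt (d := 1) rfl (P2.L ^ 1) (fun _ => 0) ![14, 12] := by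
    rw [← cubePt_add_single]
    congr 1
    funext j
    fin_cases j <;> simp
  have hplaq : ∀ p : Balaban1983to89.Plaq P2 0, ‖toC (GaugeField.plaqHol (1 : GaugeField P2 0 U1) p) - 1‖ ≤ 0 := by
    intro p
    have : GaugeField.plaqHol (1 : GaugeField P2 0 U1) p = 1 := by
      show (1 : U1) * 1 * (1 : U1)⁻¹ * (1 : U1)⁻¹ = 1
      simp
    rw [this, toC_one, sub_self, norm_zero]
  refine H P2 rfl rfl 1 le_rfl (by decide) hsz (fun _ => 0) (fun _ => 8) (fun _ => by norm_num) hfit hN0 1 20 le_rfl 14 9 1 (by norm_num)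
    le_rfl (by norm_num) hR₀N (by norm_num) (by norm_num) hgap (1 : GaugeField P2 0 U1) 0 le_rfl hplaq (by norm_num) 0 (by norm_num)
    (by norm_num) _ _ _ (cubePt_mem_cubeT rfl hz12) (fun i => ?_) ?_ (fun i => ?_) (cubePt_mem_cubeT rfl hz13) (fun i => ?_) ?_
    (fun i => ?_) f F D hF hD hsupp₁ hsupp₂
  · rw [boxCoord_cubePt rfl hfit hz12]; fin_cases i <;> norm_num
  · rw [hshift12]; exact cubePt_mem_cubeT rfl hz13
  · rw [hshift12, boxCoord_cubePt rfl hfit hz13]; fin_cases i <;> norm_num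
  · rw [boxCoord_cubePt rfl hfit hz13]; fin_cases i <;> norm_num
  · rw [hshift13]; exact cubePt_mem_cubeT rfl hz14
  · rw [hshift13, boxCoord_cubePt rfl hfit hz14]; fin_cases i <;> norm_num

end Instance

end

end Literature.MathematicalPhysics.QuantumFieldTheory.BalabanImbrieJaffe1984to88.BIJ88LocDerivHolder230SmallPlaquetteTorus
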